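import Literature.MathematicalPhysics.QuantumFieldTheory.Balaban1983to89.B3Eq14TotalExponent
import Literature.Analysis.FunctionSpaces.SmoothParametricIntegralWithin
import Mathlib.Analysis.Calculus.TangentCone.Prod

/-!
# `Balaban1983to89.B3Eq15JointSmooth` — T. Bałaban, *(Higgs)₂,₃ quantum fields in a finite volume. III.
Renormalization*, Commun. Math. Phys. **88** (1983) 411–445 [Balaban1983Higgs3], (1.4)–(1.5) p. 412 [PDF 2]:
**the auxiliary function `E_k(e′, λ′, Ω, A^{(k)}, φ)` of (1.4) is JOINTLY `C^m` in the two expansion parameters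
`(e′, λ′) ∈ ℝ × [0, δ]` for `C^m` counterterm data (`C^∞` for `C^∞` data), with all derivatives obtained by
differentiating under the integral `∫Π_j dμ_{C^{(j)}}(A′)∫dφ′↾_Ω`; consequently every function
`h_β : e′ ↦ ∂^β_{λ′}E_k(e′, ·)|_{λ′=0⁺}` whose `α`-th derivatives at `e′ = 0` are the coefficients of the repaired
perturbative sum (1.5) (`B3Eq15OneSidedInteraction.interaction15R = Σ_{1≤α+β≤n̄} (α!β!)⁻¹ ∂^α_{e′}h_β(0)`) is `C^∞`
on `ℝ`** — the double Taylor sum of (1.5) is a sum of genuine derivatives of the typed `E_k`, to every order `n̄`.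

statement-level skeleton of published theorems with citation tags; proofs where landed; nothing here is a claim about
the Yang–Mills mass gap

THE ARGUMENT (ours; the text after (1.5) takes the expansion for granted).  By `B3Eq14TotalExponent` the integrand
of (1.4) on the product space `z = (A′, φ′↾_Ω)` is `C_κe^{−W(p,z)}`, `p = (e′, λ′)`, jointly `C^m` in `p` with
`‖D^i_p(C_κe^{−W})‖ ≤ i!·max(1, B(1+‖A′‖)^m(1+Σ|φ′|²)²)^i·C_κe^{−W}` on every ball `B(p₀, 1)`.  On
`B(p₀, 1) ∩ (ℝ × [0, δ])` the effective mass `m² + δm²(e′, λ′, x)` has a positive minimum `m₀` (compactness, the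
data being continuous and the mass positive pointwise — hypothesis `hmass`), so `e^{−W} ≤ e^{K₁}e^{−c Σ|φ′|²}`,
`c = m₀(L^kε)²η^d/2` (`B3Eq14Finite.density14_le_explicit`, the quartic term dropped since `λ′ ≥ 0`), and the
polynomial weight is absorbed: `(1+Σ|φ′|²)^{2m} ≤ (2m)!t^{−2m}e^{t}e^{tΣ|φ′|²}`, `t = c/2`, while `(1+‖A′‖)^{m²}` is
integrable for the Gaussian family (`HiggsFluctMeasureExpMoments.integrable_of_polyGrowth_fluctFamily`).  This is ONE
integrable majorant of all `p`-derivatives of order `≤ m`, locally uniformly in `p` (`exists_iteratedFDeriv_fibre14_majorant`);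
the within-a-convex-set version of differentiation under the integral sign to all orders
(`Literature.Analysis.FunctionSpaces.hasFTaylorSeriesUpToOn_integral_of_dominated`, [Folland1999, Thm 2.27]) on the
convex set `S = ℝ × [0, δ]` gives the Taylor series of `p ↦ ∫C_κe^{−W}` within `S`, hence `exp(−E_k)` and (the
integral being positive, `B3Eq14Finite.integral_integrand14_pos`) `E_k = −log ∫` are `C^m` on `S`.  Finally a
`C^∞`-within-`S` function of `(e′, λ′)` has `C^∞` slices `e′ ↦ ∂^β_{λ′}|_{λ′=t}` (chain rule for `s ↦ (e′, s)`,
`ContinuousLinearMap.iteratedFDerivWithin_comp_right`, and `ContDiffWithinAt.iteratedFDerivWithin_right`), and the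
one-sided derivative within `[0, ∞)` at `0` is the one within `[0, δ]` (`B3Eq14LamAllOrders.iteratedDerivWithin_auxE_Ici_eq_Icc`).

WHAT IS PROVED (theorems; one `def` — `fibre14`, the integrand of (1.4) on the product space as a function of
`p = (e′, λ′)` —, no `Prop` fact; axioms standard).  Hypotheses (H-joint): `μ₀² > 0`, `a > 0`, `L > 1`,
`1 ≤ k ≤ K`, `L^kε ≠ 0`, `λ(L^kε) ≥ 0`, `m² > 0`, `δ > 0` where needed, `m² + δm²(e′, λ′, x) > 0` for all `e′`, all
`λ′ ∈ [0, δ]`, `x ∈ Ω₁`, and data `(e′, λ′) ↦ δm²(e′, λ′, x)` (`x ∈ Ω₁`), `E₁(e′, λ′)` jointly `C^m`: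
* §1 `fibre14`, `aestronglyMeasurable_iteratedFDeriv_fibre14`, **`exists_iteratedFDeriv_fibre14_majorant`**;
* §2 **`hasFTaylorSeriesUpToOn_integral_fibre14`**, `contDiffOn_integral_fibre14`, `iteratedFDerivWithin_integral_fibre14`
  (all `p`-derivatives of `∫C_κe^{−W}` within `S` are the integrals of the derivatives);
* §3 `integral_integrand14_eq_integral_fibre14`, **`contDiffOn_integral_integrand14_joint`**,
  **`contDiffOn_auxE_joint`** (`E_k` jointly `C^m` on `ℝ × [0, δ]`), `contDiffOn_auxE_joint_infty`;
* §4 (slices; private chain-rule lemmas) **`contDiff_iteratedDerivWithin_auxE_Icc`**,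
  **`contDiff_iteratedDerivWithin_auxE_Ici`** (`h_β` is `C^∞` on `ℝ` for every `β`),
  **`hasDerivAt_iteratedDeriv_hβ`** (each `∂^α_{e′}h_β` is the derivative of the previous one — the functions whose
  values at `0` are the coefficients of `interaction15R`), `contDiff_auxE_fst` (`e′ ↦ E_k(e′, λ′)` is `C^∞` for each
  `λ′ ∈ [0, δ]`).
HONEST SCOPE: regularity only — no value of any coefficient is computed here (orders `≤ 2` in `e′`:
`B3Eq15ChargeDerivative`, `B3Eq15ChargeSecondOrder`; all orders in `λ′` alone: `B3Eq14LamAllOrders`); the regularity is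
that of the SUPPLIED data `Data14.dm2`, `Data14.E1`; (1.5)'s bounds (1.7) are not touched.

PDF held: `paper:balaban1983-higgs-2-3-quantum-fields-finite-volume` (journal page = PDF page + 410); (1.4)–(1.5)
p. 412 [PDF 2] read from the render `run/shared/lean/pub/pub-balaban/b2b-balaban-ref1/pages/` (paper III p002):
*"The interaction after k steps is given by the formula"* (1.5) (sum over `1 ≦ α + β ≦ n̄`); that (1.5)/(I.3.62) is a
truncated TAYLOR expansion of `E_k` in `(e′, λ′)` is said in part I, p. 624 [PDF 22] (render paper I p022), after
(I.3.62): *"Because we take here an expansion until the order n̄ only, so in (3.61) we can take a whole function E_k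
instead of its expansion until the order n̄"* … *"instead of the Taylor expansion of the function E_k in the exponent
we have the function E_k(…) itself"* [Balaban1982Higgs1].  (v1.1, docstring-only: an earlier wording here put the
paraphrase «expand … with respect to e′, λ′» in quotation marks; it is not a sentence of p. 412 — corrected.)

CITATION HEADER (lean-in-tree rule).  lit-balaban TYPED SKELETON (HOME `run/shared/lean/pub/lit-balaban/`), rows
**B3.Eq1.4** / **B3.Eq1.5** (owner r15; decls of record `B3Eq14AuxFunction.Data14.auxE`,
`B3Eq15OneSidedInteraction.interaction15R`); unit `lit-balaban-typer` (literature-prover-lit-balaban-typer-g27-0).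
Nothing of any other seat is touched; no row changes head (regularity results about the typed instance).
-/

open _root_.MeasureTheory
open scoped InnerProductSpace

namespace Literature.MathematicalPhysics.QuantumFieldTheory.Balaban1983to89.B3Eq15JointSmooth

open Literature.MathematicalPhysics.QuantumFieldTheory.Balaban1983to89.HiggsLattice
open Literature.MathematicalPhysics.QuantumFieldTheory.Balaban1983to89.HiggsAveraging
open Literature.MathematicalPhysics.QuantumFieldTheory.Balaban1983to89.HiggsCovariance
open Literature.MathematicalPhysics.QuantumFieldTheory.Balaban1983to89.HiggsCovariancePos
open Literature.MathematicalPhysics.QuantumFieldTheory.Balaban1983to89.B3MultiscaleFields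
open Literature.MathematicalPhysics.QuantumFieldTheory.Balaban1983to89.HiggsFluctMeasure
open Literature.MathematicalPhysics.QuantumFieldTheory.Balaban1983to89.B1RT
open Literature.MathematicalPhysics.QuantumFieldTheory.Balaban1983to89.B3Eq14AuxFunction
open Literature.MathematicalPhysics.QuantumFieldTheory.Balaban1983to89.B3Eq15OneSidedInteraction
  (sqSum sqSum_nonneg sq_le_sqSum)
open Literature.MathematicalPhysics.QuantumFieldTheory.Balaban1983to89.B3Eq14Finite
open Literature.MathematicalPhysics.QuantumFieldTheory.Balaban1983to89.B3Eq14LamAllOrders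
  (iteratedDerivWithin_auxE_Ici_eq_Icc)
open Literature.MathematicalPhysics.QuantumFieldTheory.Balaban1983to89.HiggsFluctMeasureExpMoments
  (integrable_of_polyGrowth_fluctFamily)
open Literature.MathematicalPhysics.QuantumFieldTheory.Balaban1983to89.B3Eq14TotalExponent
open Set Filter Topology Metric Function
open scoped BigOperators ContDiff Pointwise

noncomputable section

variable {P : HiggsLattice.Params} {N : ℕ}

/-! ## 0. Slices of a function `C^n` within `univ ×ˢ I` (chain rule for `s ↦ (e, s)`) -/

section Slices

variable {E : Type*} [NormedAddCommGroup E] [NormedSpace ℝ E]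

/-- Translation in the first coordinate preserves `univ ×ˢ I`. [folklore] -/
private theorem vadd_univ_prod (I : Set ℝ) (e : ℝ) :
    (((e, (0 : ℝ)) : ℝ × ℝ) +ᵥ (univ ×ˢ I : Set (ℝ × ℝ))) = univ ×ˢ I := by
  ext p
  rw [Set.mem_vadd_set]
  constructor
  · rintro ⟨q, hq, rfl⟩
    rw [mem_prod] at hq ⊢
    refine ⟨mem_univ _, ?_⟩
    rw [vadd_eq_add, Prod.snd_add, zero_add]
    exact hq.2
  · intro hp
    rw [mem_prod] at hp
    refine ⟨p - (e, 0), ?_, ?_⟩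
    · rw [mem_prod, Prod.snd_sub, sub_zero]
      exact ⟨mem_univ _, hp.2⟩
    · rw [vadd_eq_add, add_sub_cancel]

/-- The preimage of `univ ×ˢ I` under `t ↦ (0, t)` is `I`. [folklore] -/
private theorem inr_preimage_univ_prod (I : Set ℝ) :
    (ContinuousLinearMap.inr ℝ ℝ ℝ) ⁻¹' (univ ×ˢ I : Set (ℝ × ℝ)) = I := by
  ext t
  simp [mem_prod]

/-- **The within-derivatives of a slice are components of the within-derivatives of the function**: for
`F : ℝ × ℝ → E` of class `C^n` within `univ ×ˢ I` (`I` of unique differentiability), `m ≤ n`, `t ∈ I`,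
`iteratedDerivWithin m (F (e, ·)) I t = D^m_{univ ×ˢ I} F (e, t) ((0,1), …, (0,1))`. [folklore] -/
private theorem iteratedDerivWithin_slice_snd_eq {F : ℝ × ℝ → E} {I : Set ℝ} {n : ℕ∞}
    (hF : ContDiffOn ℝ n F (univ ×ˢ I)) (hI : UniqueDiffOn ℝ I) (e : ℝ) {m : ℕ} (hm : (m : ℕ∞) ≤ n)
    {t : ℝ} (ht : t ∈ I) :
    iteratedDerivWithin m (fun s => F (e, s)) I t
      = iteratedFDerivWithin ℝ m F (univ ×ˢ I) (e, t) (fun _ => ((0 : ℝ), (1 : ℝ))) := by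
  have hS : UniqueDiffOn ℝ (univ ×ˢ I : Set (ℝ × ℝ)) := uniqueDiffOn_univ.prod hI
  have hmaps : MapsTo (fun z : ℝ × ℝ => ((e, (0 : ℝ)) : ℝ × ℝ) + z) (univ ×ˢ I) (univ ×ˢ I) := by
    intro z hz
    rw [mem_prod] at hz ⊢
    refine ⟨mem_univ _, ?_⟩
    rw [Prod.snd_add, zero_add]
    exact hz.2
  have hF₁c : ContDiffOn ℝ n (fun z : ℝ × ℝ => F (((e, (0 : ℝ)) : ℝ × ℝ) + z)) (univ ×ˢ I) :=
    hF.comp (contDiff_const.add contDiff_id).contDiffOn hmaps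
  -- translation by `(e, 0)`
  have htr : ∀ z : ℝ × ℝ, iteratedFDerivWithin ℝ m (fun z : ℝ × ℝ => F (((e, (0 : ℝ)) : ℝ × ℝ) + z)) (univ ×ˢ I) z
      = iteratedFDerivWithin ℝ m F (univ ×ˢ I) ((e, (0 : ℝ)) + z) := by
    intro z
    rw [iteratedFDerivWithin_comp_add_left, vadd_univ_prod]
  -- the linear embedding `t ↦ (0, t)`
  have hιt : (ContinuousLinearMap.inr ℝ ℝ ℝ) t ∈ (univ ×ˢ I : Set (ℝ × ℝ)) := by
    rw [ContinuousLinearMap.inr_apply, mem_prod]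
    exact ⟨mem_univ _, ht⟩
  have hpreU : UniqueDiffOn ℝ ((ContinuousLinearMap.inr ℝ ℝ ℝ) ⁻¹' (univ ×ˢ I : Set (ℝ × ℝ))) := by
    rw [inr_preimage_univ_prod]; exact hI
  have hcomp := ContinuousLinearMap.iteratedFDerivWithin_comp_right (ContinuousLinearMap.inr ℝ ℝ ℝ) hF₁c hS hpreU
    hιt (i := m) (by exact_mod_cast hm)
  rw [inr_preimage_univ_prod] at hcomp
  have hfun : ((fun z : ℝ × ℝ => F (((e, (0 : ℝ)) : ℝ × ℝ) + z)) ∘ (ContinuousLinearMap.inr ℝ ℝ ℝ))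
      = fun s => F (e, s) := by
    funext s
    rw [comp_apply, ContinuousLinearMap.inr_apply, Prod.mk_add_mk, add_zero, zero_add]
  rw [hfun] at hcomp
  rw [iteratedDerivWithin_eq_iteratedFDerivWithin, hcomp, ContinuousMultilinearMap.compContinuousLinearMap_apply,
    htr, ContinuousLinearMap.inr_apply, Prod.mk_add_mk, add_zero, zero_add]
  rfl

/-- **Slices in the free variable are `C^n`**: `u ↦ F (u, t)` is `C^n` for `t ∈ I`. [folklore] -/
private theorem contDiff_slice_fst {F : ℝ × ℝ → E} {I : Set ℝ} {n : ℕ∞} (hF : ContDiffOn ℝ n F (univ ×ˢ I))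
    {t : ℝ} (ht : t ∈ I) : ContDiff ℝ n (fun u => F (u, t)) :=
  hF.comp_contDiff (contDiff_id.prodMk contDiff_const) fun u => ⟨mem_univ u, ht⟩

/-- **The slice derivatives are `C^k` in the free variable**: for `F` of class `C^n` within `univ ×ˢ I`,
`k + m ≤ n` and `t ∈ I`, `e ↦ iteratedDerivWithin m (F (e, ·)) I t` is `C^k` (it is a component of
`e ↦ D^m_{univ ×ˢ I} F (e, t)`, which is `C^k` within `univ ×ˢ I`). [folklore] -/
private theorem contDiff_iteratedDerivWithin_slice_snd {F : ℝ × ℝ → E} {I : Set ℝ} {n : ℕ∞}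
    (hF : ContDiffOn ℝ n F (univ ×ˢ I)) (hI : UniqueDiffOn ℝ I) {k m : ℕ} (hmk : (k : ℕ∞) + m ≤ n)
    {t : ℝ} (ht : t ∈ I) :
    ContDiff ℝ k (fun e => iteratedDerivWithin m (fun s => F (e, s)) I t) := by
  have hS : UniqueDiffOn ℝ (univ ×ˢ I : Set (ℝ × ℝ)) := uniqueDiffOn_univ.prod hI
  have hm : (m : ℕ∞) ≤ n := le_trans (by exact_mod_cast Nat.le_add_left m k) hmk
  have e1 : (fun e => iteratedDerivWithin m (fun s => F (e, s)) I t)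
      = fun e => (ContinuousMultilinearMap.apply ℝ (fun _ : Fin m => ℝ × ℝ) E (fun _ => ((0 : ℝ), (1 : ℝ))))
          (iteratedFDerivWithin ℝ m F (univ ×ˢ I) (e, t)) := by
    funext e
    rw [iteratedDerivWithin_slice_snd_eq hF hI e hm ht, ContinuousMultilinearMap.apply_apply]
  rw [e1]
  have hD : ContDiffOn ℝ k (iteratedFDerivWithin ℝ m F (univ ×ˢ I)) (univ ×ˢ I) :=
    fun p hp => (hF p hp).iteratedFDerivWithin_right hS (by exact_mod_cast hmk) hp
  exact (ContinuousMultilinearMap.apply ℝ (fun _ : Fin m => ℝ × ℝ) E _).contDiff.comp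
    (hD.comp_contDiff (contDiff_id.prodMk contDiff_const) fun e => ⟨mem_univ e, ht⟩)

end Slices

/-! ## 1. The integrand on the product space as a function of `p = (e′, λ′)`; the integrable majorant -/

section Main

variable {k : ℕ} (D : Data14 P N k)

/-- The integrand `t(Ω; φ, φ′)·exp[−½⟨φ′,Δ(e′g_kA′+A^{(k)})φ′⟩ − λ′V(φ′) − ½δm²|φ′|² − E₁]` of (1.4) on the
product space `z = (A′, φ′↾_Ω)`, as a function of the pair of expansion parameters `p = (e′, λ′)` of (1.5).
[cite: Balaban1983Higgs3, (1.4)–(1.5) p.412] -/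
def fibre14 (Ak : HiggsLattice.VecField P 0) (φ : HiggsLattice.ScalarField P k N) (p : ℝ × ℝ)
    (z : ((i : Fin k) → HiggsLattice.VecField P i) × (↥D.Ω → EuclideanSpace ℝ (Fin N))) : ℝ :=
  D.kernel14 Ak p.1 z.1 φ z.2 * D.density14 Ak p.1 p.2 z.1 (extendZero D.Ω z.2)

/-- Unfolding of `fibre14`. [cite: Balaban1983Higgs3, (1.4) p.412] -/
theorem fibre14_def (Ak : HiggsLattice.VecField P 0) (φ : HiggsLattice.ScalarField P k N) (p : ℝ × ℝ)
    (z : ((i : Fin k) → HiggsLattice.VecField P i) × (↥D.Ω → EuclideanSpace ℝ (Fin N))) :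
    fibre14 D Ak φ p z = D.kernel14 Ak p.1 z.1 φ z.2 * D.density14 Ak p.1 p.2 z.1 (extendZero D.Ω z.2) := rfl

/-- The integrand is nonnegative (`a ≥ 0`). [cite: Balaban1983Higgs3, (1.4) p.412] -/
theorem fibre14_nonneg (ha : 0 ≤ D.a) (Ak : HiggsLattice.VecField P 0) (φ : HiggsLattice.ScalarField P k N)
    (p : ℝ × ℝ) (z : ((i : Fin k) → HiggsLattice.VecField P i) × (↥D.Ω → EuclideanSpace ℝ (Fin N))) :
    0 ≤ fibre14 D Ak φ p z :=
  mul_nonneg (D.kernel14_nonneg ha Ak p.1 z.1 φ z.2) (D.density14_pos Ak p.1 p.2 z.1 _).le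

/-- The integrand is jointly `C^m` in `p = (e′, λ′)` for `C^m` data (`B3Eq14TotalExponent.contDiff_fibre14`).
[cite: Balaban1983Higgs3, (1.4)–(1.5) p.412] -/
theorem contDiff_fibre14_param {m : ℕ} (hdm2 : ∀ x ∈ D.Ω₁, ContDiff ℝ m (fun p : ℝ × ℝ => D.dm2 p.1 p.2 x))
    (hE1 : ContDiff ℝ m (fun p : ℝ × ℝ => D.E1 p.1 p.2)) (Ak : HiggsLattice.VecField P 0)
    (φ : HiggsLattice.ScalarField P k N)
    (z : ((i : Fin k) → HiggsLattice.VecField P i) × (↥D.Ω → EuclideanSpace ℝ (Fin N))) :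
    ContDiff ℝ m (fun p : ℝ × ℝ => fibre14 D Ak φ p z) :=
  contDiff_fibre14 D hdm2 hE1 Ak φ z

/-- The integrand is continuous in the fields `z = (A′, φ′↾_Ω)` (`B3Eq14Finite.continuous_fibre14₄`).
[cite: Balaban1983Higgs3, (1.4) p.412] -/
theorem continuous_fibre14_field (Ak : HiggsLattice.VecField P 0) (φ : HiggsLattice.ScalarField P k N) (p : ℝ × ℝ) :
    Continuous (fibre14 D Ak φ p) :=
  continuous_fibre14₄ D p.1 p.2 continuous_const continuous_fst continuous_const continuous_snd

/-- All `p`-derivatives of the integrand are (strongly) measurable in the fields.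
[cite: Balaban1983Higgs3, (1.4)–(1.5) p.412] -/
theorem aestronglyMeasurable_iteratedFDeriv_fibre14 {m : ℕ}
    (hdm2 : ∀ x ∈ D.Ω₁, ContDiff ℝ m (fun p : ℝ × ℝ => D.dm2 p.1 p.2 x))
    (hE1 : ContDiff ℝ m (fun p : ℝ × ℝ => D.E1 p.1 p.2)) (Ak : HiggsLattice.VecField P 0)
    (φ : HiggsLattice.ScalarField P k N)
    (ν : Measure (((i : Fin k) → HiggsLattice.VecField P i) × (↥D.Ω → EuclideanSpace ℝ (Fin N)))) :
    ∀ i : ℕ, (i : ℕ∞) ≤ m → ∀ p : ℝ × ℝ,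
      AEStronglyMeasurable (fun z => iteratedFDeriv ℝ i (fun q : ℝ × ℝ => fibre14 D Ak φ q z) p) ν :=
  Literature.Analysis.FunctionSpaces.aestronglyMeasurable_iteratedFDeriv_param (n := (m : ℕ∞))
    (fun z => contDiff_fibre14_param D hdm2 hE1 Ak φ z)
    (fun p => (continuous_fibre14_field D Ak φ p).aestronglyMeasurable)

/-- A uniform positive lower bound of the effective mass `m² + δm²(e′, λ′, x)` on `B(p₀, 1) ∩ {λ′ ∈ [0, δ]}`
(compactness; the data are continuous and the mass is positive pointwise). [folklore] -/
private theorem exists_mass_lower_bound (hm2 : 0 < D.m2) {δ : ℝ}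
    (hmass : ∀ (e' s : ℝ), s ∈ Set.Icc (0 : ℝ) δ → ∀ x ∈ D.Ω₁, 0 < D.m2 + D.dm2 e' s x)
    (hcont : ∀ x ∈ D.Ω₁, Continuous (fun p : ℝ × ℝ => D.dm2 p.1 p.2 x)) (p₀ : ℝ × ℝ) :
    ∃ m₀ : ℝ, 0 < m₀ ∧ m₀ ≤ D.m2 ∧ ∀ p ∈ closedBall p₀ 1, p.2 ∈ Set.Icc (0 : ℝ) δ →
      ∀ x ∈ D.Ω₁, m₀ ≤ D.m2 + D.dm2 p.1 p.2 x := by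
  set K : Set (ℝ × ℝ) := closedBall p₀ 1 ∩ {p | p.2 ∈ Set.Icc (0 : ℝ) δ} with hK
  have hKc : IsCompact K := (isCompact_closedBall p₀ 1).inter_right (isClosed_Icc.preimage continuous_snd)
  have hcx : ∀ x : HiggsLattice.Site P 0, ∃ c : ℝ, 0 < c ∧ (x ∈ D.Ω₁ → ∀ p ∈ K, c ≤ D.m2 + D.dm2 p.1 p.2 x) := by
    intro x
    by_cases hx : x ∈ D.Ω₁
    · by_cases hKn : K.Nonempty
      · have hc : ContinuousOn (fun p : ℝ × ℝ => D.m2 + D.dm2 p.1 p.2 x) K :=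
          (continuous_const.add (hcont x hx)).continuousOn
        obtain ⟨q, hqK, hq⟩ := hKc.exists_isMinOn hKn hc
        exact ⟨D.m2 + D.dm2 q.1 q.2 x, hmass q.1 q.2 hqK.2 x hx, fun _ p hp => hq hp⟩
      · exact ⟨1, one_pos, fun _ p hp => absurd ⟨p, hp⟩ hKn⟩
    · exact ⟨1, one_pos, fun h => absurd h hx⟩
  choose c hc0 hc using hcx
  have hsum0 : 0 < 1 + ∑ x ∈ D.Ω₁, (c x)⁻¹ :=
    add_pos_of_pos_of_nonneg one_pos (Finset.sum_nonneg fun x _ => inv_nonneg.2 (hc0 x).le)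
  refine ⟨min D.m2 (1 + ∑ x ∈ D.Ω₁, (c x)⁻¹)⁻¹, lt_min hm2 (inv_pos.2 hsum0), min_le_left _ _,
    fun p hp hp2 x hx => ?_⟩
  have h1 : (c x)⁻¹ ≤ 1 + ∑ y ∈ D.Ω₁, (c y)⁻¹ :=
    (Finset.single_le_sum (fun y _ => inv_nonneg.2 (hc0 y).le) hx).trans (le_add_of_nonneg_left zero_le_one)
  calc min D.m2 (1 + ∑ y ∈ D.Ω₁, (c y)⁻¹)⁻¹ ≤ (1 + ∑ y ∈ D.Ω₁, (c y)⁻¹)⁻¹ := min_le_right _ _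
    _ ≤ ((c x)⁻¹)⁻¹ := inv_anti₀ (inv_pos.2 (hc0 x)) h1
    _ = c x := inv_inv _
    _ ≤ D.m2 + D.dm2 p.1 p.2 x := hc x hx p ⟨hp, hp2⟩

/-- The polynomial weight of the Faà di Bruno bound against half a Gaussian:
`max(1, B(1+a)^m(1+S)²)^i ≤ (1+B)^m·((2m)!t^{−2m}e^t)·(1+a)^{m²}e^{tS}` (`i ≤ m`, `t > 0`). [folklore] -/
private theorem weight_le {B a S t : ℝ} (hB : 0 ≤ B) (ha : 0 ≤ a) (hS : 0 ≤ S) (ht : 0 < t) {i m : ℕ} (hi : i ≤ m) :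
    (max 1 (B * (1 + a) ^ m * (1 + S) ^ 2)) ^ i
      ≤ (1 + B) ^ m * (((2 * m).factorial : ℝ) * t⁻¹ ^ (2 * m) * Real.exp t) * ((1 + a) ^ (m * m) * Real.exp (t * S)) := by
  have hX1 : 1 ≤ (1 + a) ^ m * (1 + S) ^ 2 :=
    one_le_mul_of_one_le_of_one_le (one_le_pow₀ (by linarith)) (one_le_pow₀ (by linarith))
  have hX0 : 0 ≤ (1 + a) ^ m * (1 + S) ^ 2 := zero_le_one.trans hX1
  have hM0 : 0 ≤ B * (1 + a) ^ m * (1 + S) ^ 2 := by positivity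
  have h1M : 1 ≤ 1 + B * (1 + a) ^ m * (1 + S) ^ 2 := by linarith
  have hmax0 : 0 ≤ max 1 (B * (1 + a) ^ m * (1 + S) ^ 2) := zero_le_one.trans (le_max_left _ _)
  have hmaxle : max 1 (B * (1 + a) ^ m * (1 + S) ^ 2) ≤ 1 + B * (1 + a) ^ m * (1 + S) ^ 2 := max_le h1M (by linarith)
  have h1MB : 1 + B * (1 + a) ^ m * (1 + S) ^ 2 ≤ (1 + B) * ((1 + a) ^ m * (1 + S) ^ 2) := by
    have h := mul_le_mul_of_nonneg_left hX1 hB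
    nlinarith [h, hX1]
  have hpow1 : (max 1 (B * (1 + a) ^ m * (1 + S) ^ 2)) ^ i ≤ (1 + B * (1 + a) ^ m * (1 + S) ^ 2) ^ m :=
    (pow_le_pow_left₀ hmax0 hmaxle i).trans (pow_le_pow_right₀ h1M hi)
  have hpow2 : (1 + B * (1 + a) ^ m * (1 + S) ^ 2) ^ m ≤ (1 + B) ^ m * (1 + a) ^ (m * m) * (1 + S) ^ (2 * m) := by
    calc (1 + B * (1 + a) ^ m * (1 + S) ^ 2) ^ m ≤ ((1 + B) * ((1 + a) ^ m * (1 + S) ^ 2)) ^ m :=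
          pow_le_pow_left₀ (by linarith) h1MB m
      _ = (1 + B) ^ m * (1 + a) ^ (m * m) * (1 + S) ^ (2 * m) := by
          rw [mul_pow, mul_pow, ← pow_mul, ← pow_mul]; ring
  have hS2m : (1 + S) ^ (2 * m) ≤ ((2 * m).factorial : ℝ) * t⁻¹ ^ (2 * m) * Real.exp t * Real.exp (t * S) := by
    have h0 : 0 ≤ t * (1 + S) := by positivity
    have h1 := Real.pow_div_factorial_le_exp (t * (1 + S)) h0 (2 * m)
    rw [div_le_iff₀ (by positivity), mul_pow, mul_add, mul_one, Real.exp_add] at h1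
    have ht2m : 0 < t ^ (2 * m) := by positivity
    calc (1 + S) ^ (2 * m) = t⁻¹ ^ (2 * m) * (t ^ (2 * m) * (1 + S) ^ (2 * m)) := by
          rw [inv_pow, ← mul_assoc, inv_mul_cancel₀ ht2m.ne', one_mul]
      _ ≤ t⁻¹ ^ (2 * m) * (Real.exp t * Real.exp (t * S) * ((2 * m).factorial : ℝ)) :=
          mul_le_mul_of_nonneg_left h1 (by positivity)
      _ = ((2 * m).factorial : ℝ) * t⁻¹ ^ (2 * m) * Real.exp t * Real.exp (t * S) := by ring
  calc (max 1 (B * (1 + a) ^ m * (1 + S) ^ 2)) ^ i ≤ (1 + B) ^ m * (1 + a) ^ (m * m) * (1 + S) ^ (2 * m) :=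
        hpow1.trans hpow2
    _ ≤ (1 + B) ^ m * (1 + a) ^ (m * m) * (((2 * m).factorial : ℝ) * t⁻¹ ^ (2 * m) * Real.exp t * Real.exp (t * S)) :=
        mul_le_mul_of_nonneg_left hS2m (by positivity)
    _ = _ := by ring

/-- The integrand against the Gaussian: for `m₀ ≤ m²`, `m₀ ≤ m² + δm²(e′, λ′, x)` (`x ∈ Ω₁`), `λ′λ(L^kε) ≥ 0` and
`−E₁(e′, λ′) ≤ K₁`: `t·exp[…] ≤ C_κ·e^{K₁}·e^{−m₀(L^kε)²η^dΣ|φ′|²/2}` (`kernel14_le`, `density14_le_explicit`).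
[cite: Balaban1983Higgs3, (1.4) p.412] -/
theorem fibre14_le_gauss (ha : 0 ≤ D.a) (hℓ : D.ell ≠ 0) {m₀ K₁ : ℝ} (hm₀ : 0 < m₀) (hm₀m : m₀ ≤ D.m2)
    (Ak : HiggsLattice.VecField P 0) (φ : HiggsLattice.ScalarField P k N) {p : ℝ × ℝ}
    (hmassp : ∀ x ∈ D.Ω₁, m₀ ≤ D.m2 + D.dm2 p.1 p.2 x) (hq : 0 ≤ p.2 * D.lamRun) (hK₁ : -D.E1 p.1 p.2 ≤ K₁)
    (z : ((i : Fin k) → HiggsLattice.VecField P i) × (↥D.Ω → EuclideanSpace ℝ (Fin N))) :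
    fibre14 D Ak φ p z ≤ ((prec (B1.aSeq D.a P.L k) (P.mesh k) P.d / (2 * Real.pi))
        ^ ((Module.finrank ℝ (EuclideanSpace ℝ (Fin N)) : ℝ) / 2)) ^ Fintype.card ↥D.Ωk
      * (Real.exp K₁ * Real.exp (-(m₀ * D.ell ^ 2 * P.mesh 0 ^ P.d / 2) * sqSum (extendZero D.Ω z.2))) := by
  have hκ0 : 0 ≤ prec (B1.aSeq D.a P.L k) (P.mesh k) P.d := by
    unfold prec
    exact mul_nonneg (D.aSeq_nonneg' ha k) (zpow_nonneg (P.mesh_pos k).le _)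
  have hCκ0 : 0 ≤ ((prec (B1.aSeq D.a P.L k) (P.mesh k) P.d / (2 * Real.pi))
      ^ ((Module.finrank ℝ (EuclideanSpace ℝ (Fin N)) : ℝ) / 2)) ^ Fintype.card ↥D.Ωk :=
    pow_nonneg (Real.rpow_nonneg (by positivity) _) _
  have hkern := kernel14_le D ha Ak p.1 z.1 φ z.2
  have hdens := density14_le_explicit D hℓ hm₀ hm₀m hmassp hq Ak z.1 (extendZero D.Ω z.2)
  have hdens0 := (D.density14_pos Ak p.1 p.2 z.1 (extendZero D.Ω z.2)).le
  have e3 : -D.E1 p.1 p.2 - m₀ * D.ell ^ 2 * P.mesh 0 ^ P.d / 2 * sqSum (extendZero D.Ω z.2)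
      = -D.E1 p.1 p.2 + -(m₀ * D.ell ^ 2 * P.mesh 0 ^ P.d / 2) * sqSum (extendZero D.Ω z.2) := by ring
  rw [e3, Real.exp_add] at hdens
  rw [fibre14_def]
  refine mul_le_mul hkern (hdens.trans ?_) hdens0 hCκ0
  exact mul_le_mul_of_nonneg_right (Real.exp_le_exp.2 hK₁) (Real.exp_pos _).le

/-- **ONE INTEGRABLE MAJORANT OF ALL `p`-DERIVATIVES OF ORDER `≤ m`, LOCALLY UNIFORMLY IN `p`** (H-joint): for every
`p₀` there is an integrable `bound` on the product space with `‖D^i_p(t·exp[…])(p, z)‖ ≤ bound(z)` for all `i ≤ m`,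
`p ∈ B(p₀, 1)` with `λ′ ∈ [0, δ]`, and all `z`; namely `C·(1 + ‖A′‖)^{m²}·Π_{x∈Ω}e^{−(c/2)|φ′(x)|²}`.
[cite: Balaban1983Higgs3, (1.4)–(1.5) p.412] -/
theorem exists_iteratedFDeriv_fibre14_majorant (hmsq : 0 < D.msq) (ha : 0 < D.a) (hL : 1 < (P.L : ℝ))
    (hk : k ≤ P.K) (hℓ : D.ell ≠ 0) (hrun : 0 ≤ D.lamRun) (hm2 : 0 < D.m2) {δ : ℝ}
    (hmass : ∀ (e' s : ℝ), s ∈ Set.Icc (0 : ℝ) δ → ∀ x ∈ D.Ω₁, 0 < D.m2 + D.dm2 e' s x)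
    {m : ℕ} (hdm2 : ∀ x ∈ D.Ω₁, ContDiff ℝ m (fun p : ℝ × ℝ => D.dm2 p.1 p.2 x))
    (hE1 : ContDiff ℝ m (fun p : ℝ × ℝ => D.E1 p.1 p.2)) (Ak : HiggsLattice.VecField P 0)
    (φ : HiggsLattice.ScalarField P k N) (p₀ : ℝ × ℝ) :
    ∃ bound : ((i : Fin k) → HiggsLattice.VecField P i) × (↥D.Ω → EuclideanSpace ℝ (Fin N)) → ℝ,
      Integrable bound ((fluctFamily P D.msq D.a k).prod volume) ∧
      ∀ i ≤ m, ∀ p ∈ closedBall p₀ 1, p.2 ∈ Set.Icc (0 : ℝ) δ →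
        ∀ z : ((i : Fin k) → HiggsLattice.VecField P i) × (↥D.Ω → EuclideanSpace ℝ (Fin N)),
          ‖iteratedFDeriv ℝ i (fun q : ℝ × ℝ => fibre14 D Ak φ q z) p‖ ≤ bound z := by
  haveI := HiggsFluctMeasurePos.fluctFamily_isProbability (P := P) hmsq ha hL hk
  -- (i) the Faà di Bruno constant of `B3Eq14TotalExponent`
  obtain ⟨B, hB0, hB⟩ := exists_norm_iteratedFDeriv_fibre14_le D ha.le hdm2 hE1 Ak φ p₀
  -- (ii) a uniform lower bound of the effective mass on `B(p₀,1) ∩ {λ′ ∈ [0, δ]}`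
  obtain ⟨m₀, hm₀0, hm₀m, hm₀K⟩ :=
    exists_mass_lower_bound D hm2 hmass (fun x hx => (hdm2 x hx).continuous) p₀
  -- (iii) a bound of `−E₁` on the ball
  obtain ⟨K₁, hK₁⟩ : ∃ K₁ : ℝ, ∀ p ∈ closedBall p₀ (1 : ℝ), -D.E1 p.1 p.2 ≤ K₁ := by
    obtain ⟨C, hC⟩ := (isCompact_closedBall p₀ (1 : ℝ)).exists_bound_of_continuousOn hE1.continuous.continuousOn
    exact ⟨C, fun p hp => (neg_le_abs _).trans ((Real.norm_eq_abs _).symm.le.trans (hC p hp))⟩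
  -- constants
  have hκ0 : 0 ≤ prec (B1.aSeq D.a P.L k) (P.mesh k) P.d := by
    unfold prec
    exact mul_nonneg (D.aSeq_nonneg' ha.le k) (zpow_nonneg (P.mesh_pos k).le _)
  set Cκ : ℝ := ((prec (B1.aSeq D.a P.L k) (P.mesh k) P.d / (2 * Real.pi))
      ^ ((Module.finrank ℝ (EuclideanSpace ℝ (Fin N)) : ℝ) / 2)) ^ Fintype.card ↥D.Ωk with hCκ
  have hCκ0 : 0 ≤ Cκ := pow_nonneg (Real.rpow_nonneg (by positivity) _) _
  have hη : 0 < P.mesh 0 ^ P.d := pow_pos (P.mesh_pos 0) _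
  have hℓ2 : 0 < D.ell ^ 2 := by positivity
  set cc : ℝ := m₀ * D.ell ^ 2 * P.mesh 0 ^ P.d / 2 with hccdef
  have hcc : 0 < cc := by positivity
  have ht : 0 < cc / 2 := half_pos hcc
  set W₀ : ℝ := (1 + B) ^ m * (((2 * m).factorial : ℝ) * (cc / 2)⁻¹ ^ (2 * m) * Real.exp (cc / 2)) with hW₀
  have hW₀0 : 0 ≤ W₀ := by positivity
  set CONST : ℝ := (m.factorial : ℝ) * W₀ * (Cκ * Real.exp K₁) with hCONST
  have hCONST0 : 0 ≤ CONST := by positivity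
  refine ⟨fun z => CONST * (1 + ‖z.1‖) ^ (m * m) * ∏ x, Real.exp (-(cc / 2) * ‖z.2 x‖ ^ 2), ?_, ?_⟩
  · -- integrability: polynomial moments of the Gaussian family × Gaussian fibre
    have h1 : Integrable (fun A' : (j : Fin k) → HiggsLattice.VecField P j => CONST * (1 + ‖A'‖) ^ (m * m))
        (fluctFamily P D.msq D.a k) := by
      refine integrable_of_polyGrowth_fluctFamily hmsq ha hL hk
        ((continuous_const.mul ((continuous_const.add continuous_norm).pow _)).aestronglyMeasurable)
        (C := CONST) (p := m * m) fun A' => ?_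
      rw [abs_of_nonneg (mul_nonneg hCONST0 (pow_nonneg (by positivity) _))]
    exact h1.mul_prod (integrable_gauss_fibre D ht)
  · intro i hi p hp hp2 z
    have hFdB := hB z i hi p hp
    have hfib := fibre14_le_gauss D ha.le hℓ hm₀0 hm₀m Ak φ (hm₀K p hp hp2) (mul_nonneg hp2.1 hrun) (hK₁ p hp) z
    rw [fibre14_def] at hfib
    have hfib0 : 0 ≤ D.kernel14 Ak p.1 z.1 φ z.2 * D.density14 Ak p.1 p.2 z.1 (extendZero D.Ω z.2) :=
      fibre14_nonneg D ha.le Ak φ p z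
    have hS0 : 0 ≤ sqSum (extendZero D.Ω z.2) := sqSum_nonneg _
    have hpoly := weight_le hB0 (norm_nonneg z.1) hS0 ht hi (m := m)
    have hmax0 : 0 ≤ max 1 (B * (1 + ‖z.1‖) ^ m * (1 + sqSum (extendZero D.Ω z.2)) ^ 2) :=
      zero_le_one.trans (le_max_left _ _)
    have hfac : (i.factorial : ℝ) ≤ m.factorial := by exact_mod_cast Nat.factorial_le hi
    have egauss : Real.exp (-(cc / 2) * sqSum (extendZero D.Ω z.2)) = ∏ x, Real.exp (-(cc / 2) * ‖z.2 x‖ ^ 2) := by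
      rw [← Real.exp_sum, sqSum_extendZero D.Ω z.2, Finset.mul_sum]
    have eexp : Real.exp (cc / 2 * sqSum (extendZero D.Ω z.2)) * Real.exp (-cc * sqSum (extendZero D.Ω z.2))
        = Real.exp (-(cc / 2) * sqSum (extendZero D.Ω z.2)) := by
      rw [← Real.exp_add]; ring_nf
    have hb0 : 0 ≤ (m.factorial : ℝ) * (W₀ * ((1 + ‖z.1‖) ^ (m * m) * Real.exp (cc / 2 * sqSum (extendZero D.Ω z.2)))) :=
      mul_nonneg (Nat.cast_nonneg _) (mul_nonneg hW₀0 (mul_nonneg (pow_nonneg (by positivity) _) (Real.exp_nonneg _)))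
    calc ‖iteratedFDeriv ℝ i (fun q : ℝ × ℝ => fibre14 D Ak φ q z) p‖
        ≤ (i.factorial : ℝ) * (max 1 (B * (1 + ‖z.1‖) ^ m * (1 + sqSum (extendZero D.Ω z.2)) ^ 2)) ^ i
            * (D.kernel14 Ak p.1 z.1 φ z.2 * D.density14 Ak p.1 p.2 z.1 (extendZero D.Ω z.2)) := hFdB
      _ ≤ (m.factorial : ℝ) * (W₀ * ((1 + ‖z.1‖) ^ (m * m) * Real.exp (cc / 2 * sqSum (extendZero D.Ω z.2))))
            * (Cκ * (Real.exp K₁ * Real.exp (-cc * sqSum (extendZero D.Ω z.2)))) :=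
          mul_le_mul (mul_le_mul hfac hpoly (pow_nonneg hmax0 _) (Nat.cast_nonneg _)) hfib hfib0 hb0
      _ = CONST * (1 + ‖z.1‖) ^ (m * m)
            * (Real.exp (cc / 2 * sqSum (extendZero D.Ω z.2)) * Real.exp (-cc * sqSum (extendZero D.Ω z.2))) := by
          rw [hCONST]; ring
      _ = CONST * (1 + ‖z.1‖) ^ (m * m) * ∏ x, Real.exp (-(cc / 2) * ‖z.2 x‖ ^ 2) := by rw [eexp, egauss]

/-! ## 2. Differentiation under the integral sign to all orders, within `S = ℝ × [0, δ]` -/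

/-- **THE TAYLOR SERIES OF `p ↦ ∫∫ t·exp[…] d(μ ⊗ dφ′↾_Ω)` WITHIN `ℝ × [0, δ]`** (H-joint, data `C^m`): up to
order `m`, with `i`-th term `p ↦ ∫∫ D^i_p(t·exp[…])(p, z)` — differentiation under the integral sign in the two
expansion parameters of (1.5), one-sided in `λ′` at `λ′ = 0`. [cite: Balaban1983Higgs3, (1.4)–(1.5) p.412] -/
theorem hasFTaylorSeriesUpToOn_integral_fibre14 (hmsq : 0 < D.msq) (ha : 0 < D.a) (hL : 1 < (P.L : ℝ))
    (hk : k ≤ P.K) (hℓ : D.ell ≠ 0) (hrun : 0 ≤ D.lamRun) (hm2 : 0 < D.m2) {δ : ℝ}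
    (hmass : ∀ (e' s : ℝ), s ∈ Set.Icc (0 : ℝ) δ → ∀ x ∈ D.Ω₁, 0 < D.m2 + D.dm2 e' s x)
    {m : ℕ} (hdm2 : ∀ x ∈ D.Ω₁, ContDiff ℝ m (fun p : ℝ × ℝ => D.dm2 p.1 p.2 x))
    (hE1 : ContDiff ℝ m (fun p : ℝ × ℝ => D.E1 p.1 p.2)) (Ak : HiggsLattice.VecField P 0)
    (φ : HiggsLattice.ScalarField P k N) :
    HasFTaylorSeriesUpToOn m
      (fun p : ℝ × ℝ => ∫ z, fibre14 D Ak φ p z ∂((fluctFamily P D.msq D.a k).prod volume))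
      (fun p i => ∫ z, iteratedFDeriv ℝ i (fun q : ℝ × ℝ => fibre14 D Ak φ q z) p
        ∂((fluctFamily P D.msq D.a k).prod volume))
      (Set.univ ×ˢ Set.Icc (0 : ℝ) δ) := by
  refine Literature.Analysis.FunctionSpaces.hasFTaylorSeriesUpToOn_integral_of_dominated (n := (m : ℕ∞))
    (convex_univ.prod (convex_Icc 0 δ)) (fun z => ?_)
    (fun i hi p _ => aestronglyMeasurable_iteratedFDeriv_fibre14 D hdm2 hE1 Ak φ _ i hi p) (fun i hi p₁ _ => ?_)
  · exact_mod_cast contDiff_fibre14_param D hdm2 hE1 Ak φ z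
  · obtain ⟨bound, hint, hb⟩ := exists_iteratedFDeriv_fibre14_majorant D hmsq ha hL hk hℓ hrun hm2 hmass hdm2 hE1 Ak φ p₁
    have him : i ≤ m := by exact_mod_cast hi
    exact ⟨1, one_pos, bound, hint, Filter.Eventually.of_forall fun z p hp =>
      hb i him p (ball_subset_closedBall hp.2) (Set.mem_prod.1 hp.1).2 z⟩

/-- **`p ↦ ∫∫ t·exp[…]` IS JOINTLY `C^m` ON `ℝ × [0, δ]`** (H-joint, data `C^m`).
[cite: Balaban1983Higgs3, (1.4)–(1.5) p.412] -/
theorem contDiffOn_integral_fibre14 (hmsq : 0 < D.msq) (ha : 0 < D.a) (hL : 1 < (P.L : ℝ))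
    (hk : k ≤ P.K) (hℓ : D.ell ≠ 0) (hrun : 0 ≤ D.lamRun) (hm2 : 0 < D.m2) {δ : ℝ}
    (hmass : ∀ (e' s : ℝ), s ∈ Set.Icc (0 : ℝ) δ → ∀ x ∈ D.Ω₁, 0 < D.m2 + D.dm2 e' s x)
    {m : ℕ} (hdm2 : ∀ x ∈ D.Ω₁, ContDiff ℝ m (fun p : ℝ × ℝ => D.dm2 p.1 p.2 x))
    (hE1 : ContDiff ℝ m (fun p : ℝ × ℝ => D.E1 p.1 p.2)) (Ak : HiggsLattice.VecField P 0)
    (φ : HiggsLattice.ScalarField P k N) :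
    ContDiffOn ℝ m (fun p : ℝ × ℝ => ∫ z, fibre14 D Ak φ p z ∂((fluctFamily P D.msq D.a k).prod volume))
      (Set.univ ×ˢ Set.Icc (0 : ℝ) δ) :=
  (hasFTaylorSeriesUpToOn_integral_fibre14 D hmsq ha hL hk hℓ hrun hm2 hmass hdm2 hE1 Ak φ).contDiffOn

/-- **ALL `p`-DERIVATIVES WITHIN `ℝ × [0, δ]` ARE THE INTEGRALS OF THE DERIVATIVES** (`δ > 0`, `i ≤ m`):
`D^i_{ℝ×[0,δ]}(∫∫ t·exp[…])(p) = ∫∫ D^i_p(t·exp[…])(p, z)`. [cite: Balaban1983Higgs3, (1.4)–(1.5) p.412] -/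
theorem iteratedFDerivWithin_integral_fibre14 (hmsq : 0 < D.msq) (ha : 0 < D.a) (hL : 1 < (P.L : ℝ))
    (hk : k ≤ P.K) (hℓ : D.ell ≠ 0) (hrun : 0 ≤ D.lamRun) (hm2 : 0 < D.m2) {δ : ℝ} (hδ : 0 < δ)
    (hmass : ∀ (e' s : ℝ), s ∈ Set.Icc (0 : ℝ) δ → ∀ x ∈ D.Ω₁, 0 < D.m2 + D.dm2 e' s x)
    {m : ℕ} (hdm2 : ∀ x ∈ D.Ω₁, ContDiff ℝ m (fun p : ℝ × ℝ => D.dm2 p.1 p.2 x))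
    (hE1 : ContDiff ℝ m (fun p : ℝ × ℝ => D.E1 p.1 p.2)) (Ak : HiggsLattice.VecField P 0)
    (φ : HiggsLattice.ScalarField P k N) {i : ℕ} (hi : i ≤ m) {p : ℝ × ℝ} (hp : p ∈ Set.univ ×ˢ Set.Icc (0 : ℝ) δ) :
    iteratedFDerivWithin ℝ i
        (fun p : ℝ × ℝ => ∫ z, fibre14 D Ak φ p z ∂((fluctFamily P D.msq D.a k).prod volume))
        (Set.univ ×ˢ Set.Icc (0 : ℝ) δ) p
      = ∫ z, iteratedFDeriv ℝ i (fun q : ℝ × ℝ => fibre14 D Ak φ q z) p ∂((fluctFamily P D.msq D.a k).prod volume) :=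
  ((hasFTaylorSeriesUpToOn_integral_fibre14 D hmsq ha hL hk hℓ hrun hm2 hmass hdm2 hE1 Ak φ).eq_iteratedFDerivWithin_of_uniqueDiffOn
    (by exact_mod_cast hi) (uniqueDiffOn_univ.prod (uniqueDiffOn_Icc hδ)) hp).symm

/-! ## 3. `exp(−E_k)` and `E_k` are jointly `C^m` on `ℝ × [0, δ]` -/

/-- On `ℝ × [0, δ]` the integral (1.4) is the integral of `fibre14` over the product space (Fubini/Tonelli,
`B3Eq14Finite.integral_integrand14_eq_integral_prod`). [cite: Balaban1983Higgs3, (1.4) p.412] -/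
theorem integral_integrand14_eq_integral_fibre14 (hmsq : 0 < D.msq) (ha : 0 < D.a) (hL : 1 < (P.L : ℝ))
    (hk : k ≤ P.K) (hℓ : D.ell ≠ 0) (hrun : 0 ≤ D.lamRun) (hm2 : 0 < D.m2) {δ : ℝ}
    (hmass : ∀ (e' s : ℝ), s ∈ Set.Icc (0 : ℝ) δ → ∀ x ∈ D.Ω₁, 0 < D.m2 + D.dm2 e' s x)
    (Ak : HiggsLattice.VecField P 0) (φ : HiggsLattice.ScalarField P k N) {p : ℝ × ℝ}
    (hp : p ∈ Set.univ ×ˢ Set.Icc (0 : ℝ) δ) :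
    ∫ A', D.integrand14 p.1 p.2 Ak φ A' ∂(fluctFamily P D.msq D.a k)
      = ∫ z, fibre14 D Ak φ p z ∂((fluctFamily P D.msq D.a k).prod volume) :=
  (integral_integrand14_eq_integral_prod D hmsq ha hL hk hm2 hℓ (mul_nonneg (Set.mem_prod.1 hp).2.1 hrun)
    (Or.inr fun x hx => hmass p.1 p.2 (Set.mem_prod.1 hp).2 x hx) Ak φ).2

/-- **`(e′, λ′) ↦ exp(−E_k(e′,λ′,Ω,A^{(k)},φ)) = ∫Π_j dμ_{C^{(j)}} T[Ω, exp[…]](φ)` IS JOINTLY `C^m` ON `ℝ × [0, δ]`**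
(H-joint, data `C^m`). [cite: Balaban1983Higgs3, (1.4)–(1.5) p.412] -/
theorem contDiffOn_integral_integrand14_joint (hmsq : 0 < D.msq) (ha : 0 < D.a) (hL : 1 < (P.L : ℝ))
    (hk : k ≤ P.K) (hℓ : D.ell ≠ 0) (hrun : 0 ≤ D.lamRun) (hm2 : 0 < D.m2) {δ : ℝ}
    (hmass : ∀ (e' s : ℝ), s ∈ Set.Icc (0 : ℝ) δ → ∀ x ∈ D.Ω₁, 0 < D.m2 + D.dm2 e' s x)
    {m : ℕ} (hdm2 : ∀ x ∈ D.Ω₁, ContDiff ℝ m (fun p : ℝ × ℝ => D.dm2 p.1 p.2 x))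
    (hE1 : ContDiff ℝ m (fun p : ℝ × ℝ => D.E1 p.1 p.2)) (Ak : HiggsLattice.VecField P 0)
    (φ : HiggsLattice.ScalarField P k N) :
    ContDiffOn ℝ m (fun p : ℝ × ℝ => ∫ A', D.integrand14 p.1 p.2 Ak φ A' ∂(fluctFamily P D.msq D.a k))
      (Set.univ ×ˢ Set.Icc (0 : ℝ) δ) :=
  (contDiffOn_integral_fibre14 D hmsq ha hL hk hℓ hrun hm2 hmass hdm2 hE1 Ak φ).congr
    fun _ hp => integral_integrand14_eq_integral_fibre14 D hmsq ha hL hk hℓ hrun hm2 hmass Ak φ hp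

/-- **`E_k(e′, λ′, Ω, A^{(k)}, φ)` IS JOINTLY `C^m` IN `(e′, λ′)` ON `ℝ × [0, δ]`** (H-joint, data `C^m`;
`E_k = −log` of a positive jointly `C^m` function): the regularity presupposed by the double expansion (1.5) of
`E_k` in `e′, λ′` *"until the order n̄"* (I p. 624), one-sided in `λ′` at `0`. [cite: Balaban1983Higgs3, (1.4)–(1.5) p.412] -/
theorem contDiffOn_auxE_joint (hmsq : 0 < D.msq) (ha : 0 < D.a) (hL : 1 < (P.L : ℝ)) (hk1 : 1 ≤ k)
    (hk : k ≤ P.K) (hℓ : D.ell ≠ 0) (hrun : 0 ≤ D.lamRun) (hm2 : 0 < D.m2) {δ : ℝ}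
    (hmass : ∀ (e' s : ℝ), s ∈ Set.Icc (0 : ℝ) δ → ∀ x ∈ D.Ω₁, 0 < D.m2 + D.dm2 e' s x)
    {m : ℕ} (hdm2 : ∀ x ∈ D.Ω₁, ContDiff ℝ m (fun p : ℝ × ℝ => D.dm2 p.1 p.2 x))
    (hE1 : ContDiff ℝ m (fun p : ℝ × ℝ => D.E1 p.1 p.2)) (Ak : HiggsLattice.VecField P 0)
    (φ : HiggsLattice.ScalarField P k N) :
    ContDiffOn ℝ m (fun p : ℝ × ℝ => D.auxE p.1 p.2 Ak φ) (Set.univ ×ˢ Set.Icc (0 : ℝ) δ) := by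
  have hZ := contDiffOn_integral_integrand14_joint D hmsq ha hL hk hℓ hrun hm2 hmass hdm2 hE1 Ak φ
  have hpos : ∀ p ∈ (Set.univ ×ˢ Set.Icc (0 : ℝ) δ : Set (ℝ × ℝ)),
      (∫ A', D.integrand14 p.1 p.2 Ak φ A' ∂(fluctFamily P D.msq D.a k)) ≠ 0 :=
    fun p hp => (integral_integrand14_pos D hmsq ha hL hk1 hk hm2 hℓ (mul_nonneg (Set.mem_prod.1 hp).2.1 hrun)
      (Or.inr fun x hx => hmass p.1 p.2 (Set.mem_prod.1 hp).2 x hx) Ak φ).ne'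
  have e : (fun p : ℝ × ℝ => D.auxE p.1 p.2 Ak φ)
      = fun p => -Real.log (∫ A', D.integrand14 p.1 p.2 Ak φ A' ∂(fluctFamily P D.msq D.a k)) := rfl
  rw [e]
  exact (hZ.log hpos).neg

/-- **`E_k` IS JOINTLY `C^∞` ON `ℝ × [0, δ]` FOR `C^∞` DATA** (H-joint). [cite: Balaban1983Higgs3, (1.4)–(1.5) p.412] -/
theorem contDiffOn_auxE_joint_infty (hmsq : 0 < D.msq) (ha : 0 < D.a) (hL : 1 < (P.L : ℝ)) (hk1 : 1 ≤ k)
    (hk : k ≤ P.K) (hℓ : D.ell ≠ 0) (hrun : 0 ≤ D.lamRun) (hm2 : 0 < D.m2) {δ : ℝ}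
    (hmass : ∀ (e' s : ℝ), s ∈ Set.Icc (0 : ℝ) δ → ∀ x ∈ D.Ω₁, 0 < D.m2 + D.dm2 e' s x)
    (hdm2 : ∀ x ∈ D.Ω₁, ContDiff ℝ ∞ (fun p : ℝ × ℝ => D.dm2 p.1 p.2 x))
    (hE1 : ContDiff ℝ ∞ (fun p : ℝ × ℝ => D.E1 p.1 p.2)) (Ak : HiggsLattice.VecField P 0)
    (φ : HiggsLattice.ScalarField P k N) :
    ContDiffOn ℝ ∞ (fun p : ℝ × ℝ => D.auxE p.1 p.2 Ak φ) (Set.univ ×ˢ Set.Icc (0 : ℝ) δ) :=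
  contDiffOn_infty.2 fun _ => contDiffOn_auxE_joint D hmsq ha hL hk1 hk hℓ hrun hm2 hmass
    (fun x hx => (hdm2 x hx).of_le (mod_cast le_top)) (hE1.of_le (mod_cast le_top)) Ak φ

/-! ## 4. The slices: every `h_β : e′ ↦ ∂^β_{λ′}E_k(e′,·)|_{0⁺}` of the repaired (1.5) is `C^∞` -/

/-- **`e′ ↦ E_k(e′, λ′, Ω, A^{(k)}, φ)` IS `C^∞` FOR EACH `λ′ ∈ [0, δ]`** (`C^∞` data, H-joint): the two-sided
`e′`-derivatives of (1.5) exist to all orders. [cite: Balaban1983Higgs3, (1.5) p.412] -/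
theorem contDiff_auxE_fst (hmsq : 0 < D.msq) (ha : 0 < D.a) (hL : 1 < (P.L : ℝ)) (hk1 : 1 ≤ k)
    (hk : k ≤ P.K) (hℓ : D.ell ≠ 0) (hrun : 0 ≤ D.lamRun) (hm2 : 0 < D.m2) {δ : ℝ}
    (hmass : ∀ (e' s : ℝ), s ∈ Set.Icc (0 : ℝ) δ → ∀ x ∈ D.Ω₁, 0 < D.m2 + D.dm2 e' s x)
    (hdm2 : ∀ x ∈ D.Ω₁, ContDiff ℝ ∞ (fun p : ℝ × ℝ => D.dm2 p.1 p.2 x))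
    (hE1 : ContDiff ℝ ∞ (fun p : ℝ × ℝ => D.E1 p.1 p.2)) (Ak : HiggsLattice.VecField P 0)
    (φ : HiggsLattice.ScalarField P k N) {s : ℝ} (hs : s ∈ Set.Icc (0 : ℝ) δ) {n : ℕ∞} :
    ContDiff ℝ n (fun e' => D.auxE e' s Ak φ) :=
  (contDiff_slice_fst (F := fun p : ℝ × ℝ => D.auxE p.1 p.2 Ak φ)
    (contDiffOn_auxE_joint_infty D hmsq ha hL hk1 hk hℓ hrun hm2 hmass hdm2 hE1 Ak φ) hs).of_le (mod_cast le_top)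

/-- **`h_β : e′ ↦ ∂^β_{λ′}E_k(e′, ·)` (DERIVATIVE WITHIN `[0, δ]` AT `λ′ = t ∈ [0, δ]`) IS `C^∞` ON `ℝ`** for every
`β` (`C^∞` data, H-joint, `δ > 0`). [cite: Balaban1983Higgs3, (1.5) p.412] -/
theorem contDiff_iteratedDerivWithin_auxE_Icc (hmsq : 0 < D.msq) (ha : 0 < D.a) (hL : 1 < (P.L : ℝ)) (hk1 : 1 ≤ k)
    (hk : k ≤ P.K) (hℓ : D.ell ≠ 0) (hrun : 0 ≤ D.lamRun) (hm2 : 0 < D.m2) {δ : ℝ} (hδ : 0 < δ)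
    (hmass : ∀ (e' s : ℝ), s ∈ Set.Icc (0 : ℝ) δ → ∀ x ∈ D.Ω₁, 0 < D.m2 + D.dm2 e' s x)
    (hdm2 : ∀ x ∈ D.Ω₁, ContDiff ℝ ∞ (fun p : ℝ × ℝ => D.dm2 p.1 p.2 x))
    (hE1 : ContDiff ℝ ∞ (fun p : ℝ × ℝ => D.E1 p.1 p.2)) (Ak : HiggsLattice.VecField P 0)
    (φ : HiggsLattice.ScalarField P k N) (β : ℕ) {t : ℝ} (ht : t ∈ Set.Icc (0 : ℝ) δ) {n : ℕ} :
    ContDiff ℝ n (fun e' => iteratedDerivWithin β (fun s => D.auxE e' s Ak φ) (Set.Icc 0 δ) t) :=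
  contDiff_iteratedDerivWithin_slice_snd (F := fun p : ℝ × ℝ => D.auxE p.1 p.2 Ak φ)
    (contDiffOn_auxE_joint_infty D hmsq ha hL hk1 hk hℓ hrun hm2 hmass hdm2 hE1 Ak φ) (uniqueDiffOn_Icc hδ)
    (mod_cast le_top) ht

/-- **EVERY `h_β : e′ ↦ ∂^β_{λ′}E_k(e′, ·)|_{λ′=0⁺}` OF THE REPAIRED (1.5) IS `C^∞` ON `ℝ`** (the one-sided
derivative within `[0, ∞)` at `0` entering `B3Eq15OneSidedInteraction.interaction15R`; `C^∞` data, H-joint, `δ > 0`):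
the functions whose `α`-th derivatives at `e′ = 0` are the coefficients `∂^α_{e′}∂^β_{λ′}E_k(0, 0⁺)` of
`interaction15R = Σ_{1≤α+β≤n̄}(α!β!)⁻¹(…)` are smooth — each term of the double Taylor sum (1.5) is a genuine
derivative of the typed `E_k`, for every `n̄`. [cite: Balaban1983Higgs3, (1.5) p.412] -/
theorem contDiff_iteratedDerivWithin_auxE_Ici (hmsq : 0 < D.msq) (ha : 0 < D.a) (hL : 1 < (P.L : ℝ)) (hk1 : 1 ≤ k)
    (hk : k ≤ P.K) (hℓ : D.ell ≠ 0) (hrun : 0 ≤ D.lamRun) (hm2 : 0 < D.m2) {δ : ℝ} (hδ : 0 < δ)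
    (hmass : ∀ (e' s : ℝ), s ∈ Set.Icc (0 : ℝ) δ → ∀ x ∈ D.Ω₁, 0 < D.m2 + D.dm2 e' s x)
    (hdm2 : ∀ x ∈ D.Ω₁, ContDiff ℝ ∞ (fun p : ℝ × ℝ => D.dm2 p.1 p.2 x))
    (hE1 : ContDiff ℝ ∞ (fun p : ℝ × ℝ => D.E1 p.1 p.2)) (Ak : HiggsLattice.VecField P 0)
    (φ : HiggsLattice.ScalarField P k N) (β : ℕ) {n : ℕ} :
    ContDiff ℝ n (fun e' => iteratedDerivWithin β (fun l' => D.auxE e' l' Ak φ) (Set.Ici 0) 0) := by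
  have e : (fun e' => iteratedDerivWithin β (fun l' => D.auxE e' l' Ak φ) (Set.Ici 0) 0)
      = fun e' => iteratedDerivWithin β (fun s => D.auxE e' s Ak φ) (Set.Icc 0 δ) 0 := by
    funext e'
    exact iteratedDerivWithin_auxE_Ici_eq_Icc D hδ e' Ak φ β
  rw [e]
  exact contDiff_iteratedDerivWithin_auxE_Icc D hmsq ha hL hk1 hk hℓ hrun hm2 hδ hmass hdm2 hE1 Ak φ β
    ⟨le_rfl, hδ.le⟩

/-- **EACH `(α, β)` TERM OF `interaction15R` IS THE VALUE AT `0` OF A DIFFERENTIABLE FUNCTION WHOSE DERIVATIVE IS THE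
`(α+1, β)` FUNCTION**: `e′ ↦ ∂^α_{e′}h_β(e′)` has derivative `∂^{α+1}_{e′}h_β(e′)` everywhere (`C^∞` data, H-joint,
`δ > 0`). [cite: Balaban1983Higgs3, (1.5) p.412] -/
theorem hasDerivAt_iteratedDeriv_hβ (hmsq : 0 < D.msq) (ha : 0 < D.a) (hL : 1 < (P.L : ℝ)) (hk1 : 1 ≤ k)
    (hk : k ≤ P.K) (hℓ : D.ell ≠ 0) (hrun : 0 ≤ D.lamRun) (hm2 : 0 < D.m2) {δ : ℝ} (hδ : 0 < δ)
    (hmass : ∀ (e' s : ℝ), s ∈ Set.Icc (0 : ℝ) δ → ∀ x ∈ D.Ω₁, 0 < D.m2 + D.dm2 e' s x)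
    (hdm2 : ∀ x ∈ D.Ω₁, ContDiff ℝ ∞ (fun p : ℝ × ℝ => D.dm2 p.1 p.2 x))
    (hE1 : ContDiff ℝ ∞ (fun p : ℝ × ℝ => D.E1 p.1 p.2)) (Ak : HiggsLattice.VecField P 0)
    (φ : HiggsLattice.ScalarField P k N) (α β : ℕ) (e₀ : ℝ) :
    HasDerivAt (iteratedDeriv α (fun e' => iteratedDerivWithin β (fun l' => D.auxE e' l' Ak φ) (Set.Ici 0) 0))
      (iteratedDeriv (α + 1) (fun e' => iteratedDerivWithin β (fun l' => D.auxE e' l' Ak φ) (Set.Ici 0) 0) e₀) e₀ := by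
  have h := contDiff_iteratedDerivWithin_auxE_Ici D hmsq ha hL hk1 hk hℓ hrun hm2 hδ hmass hdm2 hE1 Ak φ β (n := α + 1)
  rw [iteratedDeriv_succ]
  exact ((h.differentiable_iteratedDeriv α (by exact_mod_cast Nat.lt_succ_self α)) e₀).hasDerivAt

end Main

end

end Literature.MathematicalPhysics.QuantumFieldTheory.Balaban1983to89.B3Eq15JointSmooth
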